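import Literature.NumberTheory.GaloisRepresentations.AbsGaloisConjBy
import Literature.NumberTheory.NumberFields.FrobeniusLiftAlgebraicClosure
import HarnessLib

/-!
# Conjugation of `Gal(K̄/K)` by a semilinear automorphism `σ̃` of `K̄` at a prime `𝔓` fixed by `σ̃`:
# `σ̃ 𝔓 = 𝔓`, inertia and Frobenius

Setting: `K` a field, `K̄ = AlgebraicClosure K`, `γ : K ≃+* K` and a ring automorphism
`σ̃ : K̄ ≃+* K̄` lifting `γ` (`σ̃ ∘ (K → K̄) = (K → K̄) ∘ γ`), so that `τ ↦ σ̃⁻¹ τ σ̃` is the group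
endomorphism `absGalConjBy σ̃ γ hσa` of `Γ_K = Field.absoluteGaloisGroup K`
(`AbsGaloisConjBy.lean`).  Suppose `σ̃` satisfies a Frobenius-type congruence at a maximal ideal `𝔓`
of the ring `\bar ℤ_K = absIntegers (𝓞 K) K` of algebraic integers — `σ̃ x ≡ x ^ q (mod 𝔓)` for all
`x ∈ \bar ℤ_K`, with `q ≥ 1`; this is exactly clause 2 of
`Literature.NumberTheory.NumberFields.exists_algEquiv_algebraicClosure_lift_of_isArithFrobAt`
(a lift to `K̄` of an arithmetic Frobenius `γ` at `v`, at a prime `𝔓 ∣ v`).  Then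

* `apply_mem_prime_iff_of_sub_pow_mem`, `symm_apply_mem_prime_iff_of_sub_pow_mem`: `σ̃ 𝔓 = 𝔓`
  (`σ̃ 𝔓 ⊆ 𝔓` from the congruence and `x ^ q ∈ 𝔓`; equality because `σ̃` restricts to a ring
  automorphism of `\bar ℤ_K` — `exists_ringEquiv_absIntegers_coe_eq` — whose pull-back of the maximal
  ideal `𝔓` is proper and contains `𝔓`);
* `absGalConjBy_mem_inertia`: **conjugation by `σ̃` preserves the inertia group `I_𝔓 ≤ Γ_K`**,
  `(σ̃⁻¹τσ̃) x - x = σ̃⁻¹ (τ (σ̃ x) - σ̃ x) ∈ σ̃⁻¹ 𝔓 = 𝔓`;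
* `isArithFrobAt_absGalConjBy`: **conjugation by `σ̃` preserves arithmetic Frobenius elements at `𝔓`**
  (`IsArithFrobAt (𝓞 K) τ 𝔓`, i.e. `τ x ≡ x ^ N𝔭 (mod 𝔓)`),
  `(σ̃⁻¹τσ̃) x - x ^ N𝔭 = σ̃⁻¹ (τ (σ̃ x) - (σ̃ x) ^ N𝔭) ∈ σ̃⁻¹ 𝔓 = 𝔓`.

This is leaf **L3b** of the cell's E4 transport file (`GoodReductionAt.TateSpecialisation.conjFrob`;
Shimura, *Abelian varieties with complex multiplication* (1998), §18.6 p. 129 (3) and §11.1 proof of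
Prop. 14 (p. 83): the Frobenius lift `σ` of `[𝔭, K]` to `\bar ℚ` and the transport of `𝔓`-adic data
along it — the transported Tate-specialisation datum has the same prime `𝔓`, and its inertia /
Frobenius clauses are read through `σ̃⁻¹ I_𝔓 σ̃ = I_𝔓`, `σ̃⁻¹ Frob_𝔓 σ̃ = Frob_𝔓`).  Harness slots L3b-1 /
L3b-2 of `ConjFrob-harness.lean` (cell hodgecm-mathlib, lead B-p09), signatures verbatim.

Relation to existing tree material (cited, not restated): `AbsGaloisOuterConj.lean` treats the OUTER
action of `Γ_F` on `Γ_M` for a Galois extension `M/F` through the fixed embedding `F̄ → M̄`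
(`absGaloisOuterConj_mem_inertia_iff`, `isArithFrobAt_absGaloisOuterConj_iff`, with the conjugate
prime `τ ⋆ 𝔔`); here the conjugating datum is an abstract ring automorphism `σ̃` of `K̄` over an
automorphism `γ` of `K` FIXING the prime (no base field, no Galois hypothesis, no chosen embedding),
the currency of `exists_algEquiv_algebraicClosure_lift_of_isArithFrobAt` and of clause `(2′)` of
`GoodReductionAt.HomReduction.exists_isTateCompatible_family_conjFrob`.  Integrality of `σ̃ x` is the
tree's `ringEquiv_apply_mem_absIntegers` / `exists_ringEquiv_absIntegers_coe_eq`; `Γ_K`, its actions,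
`Ideal.inertia` and `IsArithFrobAt` are Mathlib's / `AbsGaloisGroup`'s; `absGalConjBy(_smul)` is
`AbsGaloisConjBy`'s.

Sources: J. Neukirch, *Algebraic Number Theory* (1999), Ch. I §9 (σ𝒪 = 𝒪, Prop. (9.1), (9.4)–(9.6),
`G_{σ𝔓} = σ G_𝔓 σ⁻¹`); J.-P. Serre, *Abelian ℓ-adic representations and elliptic curves* (1968),
Ch. I §2.1; G. Shimura (1998), §11.1 Prop. 14, §18.6.  Theorems only: no `def`, no named fact, no `sorry`.
-/

set_option autoImplicit false

noncomputable section

open scoped Pointwise NumberField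
open NumberField Field
open Literature.NumberTheory.NumberFields

namespace Literature.NumberTheory.GaloisRepresentations


/-! ### §L3b  A prime `𝔓` of `\bar ℤ_K` with `σ̃ x ≡ x ^ q (mod 𝔓)`: `σ̃ 𝔓 = 𝔓`, inertia, Frobenius -/

section Prime

variable {K : Type} [Field K] (σt : AlgebraicClosure K ≃+* AlgebraicClosure K)
  (𝔓 : Ideal (absIntegers (𝓞 K) K)) (q : ℕ)
  (hσ𝔓 : ∀ x : absIntegers (𝓞 K) K, ∃ hx : σt x ∈ absIntegers (𝓞 K) K,
    (⟨σt x, hx⟩ : absIntegers (𝓞 K) K) - x ^ q ∈ 𝔓)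

include hσ𝔓

/-- If `σ̃ x ≡ x ^ q (mod 𝔓)` for all algebraic integers `x` and `q ≥ 1`, then `σ̃ 𝔓 ⊆ 𝔓`.
[cite: NeukirchANT1999, Ch. I §9 Def. (9.5) (an arithmetic Frobenius stabilises its prime)] -/
theorem apply_mem_prime_of_sub_pow_mem (hq : 1 ≤ q) {x : absIntegers (𝓞 K) K} (hx𝔓 : x ∈ 𝔓) :
    (⟨σt x, (hσ𝔓 x).1⟩ : absIntegers (𝓞 K) K) ∈ 𝔓 := by
  obtain ⟨hx, h⟩ := hσ𝔓 x
  have hpow : x ^ q ∈ 𝔓 := Ideal.pow_mem_of_mem 𝔓 hx𝔓 q hq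
  simpa using 𝔓.add_mem h hpow

/-- If `σ̃ x ≡ x ^ q (mod 𝔓)` for all algebraic integers `x`, `q ≥ 1` and `𝔓` is maximal, then
`σ̃ 𝔓 = 𝔓`: `σ̃ x ∈ 𝔓 ↔ x ∈ 𝔓` (`σ̃` restricts to a ring automorphism of `\bar ℤ_K` whose pull-back of
`𝔓` is a proper ideal containing `𝔓`).
[cite: NeukirchANT1999, Ch. I §9 Def. (9.5) and Prop. (9.1) (σ𝒪 = 𝒪)] -/
theorem apply_mem_prime_iff_of_sub_pow_mem [𝔓.IsMaximal] (hq : 1 ≤ q) (x : absIntegers (𝓞 K) K) :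
    (⟨σt x, (hσ𝔓 x).1⟩ : absIntegers (𝓞 K) K) ∈ 𝔓 ↔ x ∈ 𝔓 := by
  obtain ⟨g, hg, -⟩ := exists_ringEquiv_absIntegers_coe_eq (L := K) σt
  have hgx : ∀ y : absIntegers (𝓞 K) K, g y = ⟨σt y, (hσ𝔓 y).1⟩ := fun y => Subtype.ext (hg y)
  have hle : 𝔓 ≤ 𝔓.comap (g : absIntegers (𝓞 K) K →+* absIntegers (𝓞 K) K) := by
    intro y hy
    rw [Ideal.mem_comap, RingHom.coe_coe, hgx]
    exact apply_mem_prime_of_sub_pow_mem σt 𝔓 q hσ𝔓 hq hy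
  have hmax : (𝔓.comap (g : absIntegers (𝓞 K) K →+* absIntegers (𝓞 K) K)).IsMaximal :=
    Ideal.comap_isMaximal_of_surjective _ g.surjective
  have heq : 𝔓.comap (g : absIntegers (𝓞 K) K →+* absIntegers (𝓞 K) K) = 𝔓 :=
    (Ideal.IsMaximal.eq_of_le ‹𝔓.IsMaximal› hmax.ne_top hle).symm
  constructor
  · intro h
    have h' : x ∈ 𝔓.comap (g : absIntegers (𝓞 K) K →+* absIntegers (𝓞 K) K) := by
      rw [Ideal.mem_comap, RingHom.coe_coe, hgx]; exact h
    rwa [heq] at h'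
  · intro h
    exact apply_mem_prime_of_sub_pow_mem σt 𝔓 q hσ𝔓 hq h

/-- Same hypotheses: `σ̃⁻¹ 𝔓 = 𝔓`, i.e. `σ̃⁻¹ x ∈ 𝔓 ↔ x ∈ 𝔓` for algebraic integers `x`.
[cite: NeukirchANT1999, Ch. I §9 Def. (9.5) and Prop. (9.1)] -/
theorem symm_apply_mem_prime_iff_of_sub_pow_mem [𝔓.IsMaximal] (hq : 1 ≤ q) (x : absIntegers (𝓞 K) K) :
    (⟨σt.symm x, ringEquiv_apply_mem_absIntegers σt.symm x.2⟩ : absIntegers (𝓞 K) K) ∈ 𝔓 ↔ x ∈ 𝔓 := by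
  have h := apply_mem_prime_iff_of_sub_pow_mem σt 𝔓 q hσ𝔓 hq
    ⟨σt.symm x, ringEquiv_apply_mem_absIntegers σt.symm x.2⟩
  have hx : (⟨σt ((⟨σt.symm x, ringEquiv_apply_mem_absIntegers σt.symm x.2⟩ : absIntegers (𝓞 K) K) :
      AlgebraicClosure K), (hσ𝔓 ⟨σt.symm x, ringEquiv_apply_mem_absIntegers σt.symm x.2⟩).1⟩ :
        absIntegers (𝓞 K) K) = x :=
    Subtype.ext (σt.apply_symm_apply _)
  rw [hx] at h
  exact h.symm

variable (γ : K ≃+* K)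
  (hσa : ∀ a : K, σt (algebraMap K (AlgebraicClosure K) a) = algebraMap K (AlgebraicClosure K) (γ a))

omit hσ𝔓 in
/-- The action of `σ̃⁻¹τσ̃ = absGalConjBy σ̃ γ hσa τ` on an algebraic integer, on underlying elements of
`K̄`: `((σ̃⁻¹τσ̃) • x : K̄) = σ̃⁻¹ (τ • σ̃ x)` (`integralClosure.coe_smul` + `absGalConjBy_smul`).
[cite: NeukirchANT1999, Ch. I §9 (σ𝒪 = 𝒪, before Prop. (9.1))] -/
theorem coe_absGalConjBy_smul_absIntegers (τ : Field.absoluteGaloisGroup K) (x : absIntegers (𝓞 K) K) :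
    ((absGalConjBy σt γ hσa τ • x : absIntegers (𝓞 K) K) : AlgebraicClosure K) =
      σt.symm (τ • σt (x : AlgebraicClosure K)) := by
  rw [integralClosure.coe_smul, absGalConjBy_smul]

/-- **Conjugation by `σ̃` preserves the inertia group of `𝔓`** (`𝔓` maximal, `σ̃ x ≡ x ^ q (mod 𝔓)`,
`q ≥ 1`): for `τ ∈ I_𝔓`, `σ̃⁻¹τσ̃ ∈ I_𝔓`, since `(σ̃⁻¹τσ̃) x - x = σ̃⁻¹ (τ (σ̃ x) - σ̃ x) ∈ σ̃⁻¹ 𝔓 = 𝔓`.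
(Harness slot L3b-1.) [cite: NeukirchANT1999, Ch. I §9 (9.6) and the remark after (9.5) (I_{σ𝔓} = σ I_𝔓 σ⁻¹)] -/
theorem absGalConjBy_mem_inertia [𝔓.IsMaximal] (hq : 1 ≤ q) {τ : Field.absoluteGaloisGroup K}
    (hτ : τ ∈ 𝔓.inertia (Field.absoluteGaloisGroup K)) :
    absGalConjBy σt γ hσa τ ∈ 𝔓.inertia (Field.absoluteGaloisGroup K) := by
  intro x
  set y : absIntegers (𝓞 K) K := ⟨σt x, (hσ𝔓 x).1⟩ with hy_def
  have hy : τ • y - y ∈ 𝔓 := hτ y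
  have key : absGalConjBy σt γ hσa τ • x - x =
      ⟨σt.symm ((τ • y - y : absIntegers (𝓞 K) K) : AlgebraicClosure K),
        ringEquiv_apply_mem_absIntegers σt.symm (τ • y - y).2⟩ := by
    apply Subtype.ext
    simp only [hy_def, Subalgebra.coe_sub, integralClosure.coe_smul, map_sub, absGalConjBy_smul,
      RingEquiv.symm_apply_apply]
  rw [key]
  exact (symm_apply_mem_prime_iff_of_sub_pow_mem σt 𝔓 q hσ𝔓 hq _).mpr hy

/-- **Conjugation by `σ̃` preserves arithmetic Frobenius elements at `𝔓`** (`𝔓` maximal,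
`σ̃ x ≡ x ^ q (mod 𝔓)`, `q ≥ 1`): if `τ x ≡ x ^ N𝔭 (mod 𝔓)` for all `x` (`IsArithFrobAt (𝓞 K) τ 𝔓`,
`N𝔭 = #(𝓞 K / 𝔓 ∩ 𝓞 K)`), then the same holds for `σ̃⁻¹τσ̃`, since
`(σ̃⁻¹τσ̃) x - x ^ N𝔭 = σ̃⁻¹ (τ (σ̃ x) - (σ̃ x) ^ N𝔭) ∈ σ̃⁻¹ 𝔓 = 𝔓`.  (Harness slot L3b-2.)
[cite: NeukirchANT1999, Ch. I §9 Prop. (9.4)–(9.5) and the remark after (9.5)] [cite: Shimura1998, §11.1 proof of Prop. 14 (p. 83)] -/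
theorem isArithFrobAt_absGalConjBy [𝔓.IsMaximal] (hq : 1 ≤ q) {τ : Field.absoluteGaloisGroup K}
    (hτ : IsArithFrobAt (𝓞 K) τ 𝔓) : IsArithFrobAt (𝓞 K) (absGalConjBy σt γ hσa τ) 𝔓 := by
  intro x
  rw [MulSemiringAction.toAlgHom_apply]
  set y : absIntegers (𝓞 K) K := ⟨σt x, (hσ𝔓 x).1⟩ with hy_def
  have hy : τ • y - y ^ Nat.card (𝓞 K ⧸ 𝔓.under (𝓞 K)) ∈ 𝔓 := by
    have h := hτ y
    rwa [MulSemiringAction.toAlgHom_apply] at h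
  have key : absGalConjBy σt γ hσa τ • x - x ^ Nat.card (𝓞 K ⧸ 𝔓.under (𝓞 K)) =
      ⟨σt.symm ((τ • y - y ^ Nat.card (𝓞 K ⧸ 𝔓.under (𝓞 K)) : absIntegers (𝓞 K) K) :
          AlgebraicClosure K),
        ringEquiv_apply_mem_absIntegers σt.symm (τ • y - y ^ Nat.card (𝓞 K ⧸ 𝔓.under (𝓞 K))).2⟩ := by
    apply Subtype.ext
    simp only [hy_def, Subalgebra.coe_sub, Subalgebra.coe_pow, integralClosure.coe_smul, map_sub, map_pow,
      absGalConjBy_smul, RingEquiv.symm_apply_apply]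
  rw [key]
  exact (symm_apply_mem_prime_iff_of_sub_pow_mem σt 𝔓 q hσ𝔓 hq _).mpr hy

end Prime

end Literature.NumberTheory.GaloisRepresentations

end
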